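import Mathlib
import Literature.MathematicalPhysics.QuantumFieldTheory.Balaban1983to89.BlockAveragingSectionPlaq
import Literature.MathematicalPhysics.QuantumFieldTheory.Balaban1983to89.B10Eq5RegularAction
import Literature.MathematicalPhysics.QuantumFieldTheory.Balaban1983to89.T3DescentFibreTower
import Literature.MathematicalPhysics.QuantumFieldTheory.Balaban1983to89.T3NestedUnitLaws

/-!
# Twisted fibre vs the organ — lemma (W): the WILD lift (central-sign twist of the face section)

Companion to `Lines/organ_twisted_fibre.lean` (§2b: the SMOOTH slice lift = the tree's face section, `descend_sliceLift`,
`wilsonAction4_sliceLift`).  Here the second geometric input of the blueprint (dossier §2 (W)): for every coarse field `V` a fine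
field `U^w` in the SAME averaging fibre (`descend U^w = V`) whose Wilson action is a fixed positive fraction of the number of fine
plaquettes, INDEPENDENTLY of `V`.  Construction: multiply the face section by a central element `z` (`z = −1 ∈ Z(SU(2))`) on a
set `M` of bonds of ONE direction `μ₀`, chosen inside the blocks (μ₀-offset in `[1, L−3]`), off the central plane (ν₁-offset
`≠ (L−1)/2`) and with a parity condition (ν₁-offset + ν₂-offset even).  Since `z` is central every (0.4) loop variable of `U^w`
is `1` or `z`, so the correction factor is `1` in either branch of the small-field guard (`dist1 z ≥ δ`); no bond of `M` lies on a
central line, so the straight transporters are those of the section; hence `avgFun ℰ U^w = V`.  Every plaquette `⟨x, μ₀, ν₂⟩`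
with `x`-offsets `(a+1, b', c)`, `a < L−3`, `b' ≠ (L−1)/2`, `c < L−1`, contains exactly one bond of `M` and no edge bond, so its
plaquette variable is `z` and contributes `1 − reTr z` (= 2 for `z = −1 ∈ SU(2)`).

Nothing here is a summit / rung / crux proof; it is one elementary input of the construction stub `stub_twistedPair`.
-/

namespace Summit.QuantumFields.YangMills.Cruxes.OneStepBackwardContraction.TwistedFibre.WildLift

open Literature.MathematicalPhysics.QuantumFieldTheory.Balaban1983to89 T4Continuum AveragingRT BlockAveraging
  BlockAveragingSection BlockAveragingSectionPlaq

noncomputable section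

section Generic

variable {P : Params} {j : ℕ} {G : Type*} [GaugeGroup G]

/-! ## §1 Central elements: holonomies of a centrally twisted field factor -/

theorem central_inv {z : G} (hz : ∀ g : G, z * g = g * z) (g : G) : z⁻¹ * g = g * z⁻¹ := by
  have h := hz g
  calc z⁻¹ * g = z⁻¹ * (g * z) * z⁻¹ := by group
    _ = z⁻¹ * (z * g) * z⁻¹ := by rw [h]
    _ = g * z⁻¹ := by group

/-- The holonomy of a field of central elements is central. [folklore] -/
theorem central_holAt (ε : GaugeField P j G) (hε : ∀ b (g : G), ε b * g = g * ε b) :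
    ∀ (γ : List (LStep P j)) (g : G), holAt ε γ * g = g * holAt ε γ
  | [], g => by rw [holAt_nil, one_mul, mul_one]
  | s :: γ, g => by
    rw [holAt_cons]
    have hs : (if s.fwd then ε s.bond else (ε s.bond)⁻¹) * g = g * (if s.fwd then ε s.bond else (ε s.bond)⁻¹) := by
      split_ifs
      · exact hε _ _
      · exact central_inv (hε s.bond) g
    calc (if s.fwd then ε s.bond else (ε s.bond)⁻¹) * holAt ε γ * g
        = (if s.fwd then ε s.bond else (ε s.bond)⁻¹) * (holAt ε γ * g) := by rw [mul_assoc]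
      _ = (if s.fwd then ε s.bond else (ε s.bond)⁻¹) * (g * holAt ε γ) := by rw [central_holAt ε hε γ g]
      _ = ((if s.fwd then ε s.bond else (ε s.bond)⁻¹) * g) * holAt ε γ := by rw [mul_assoc]
      _ = (g * (if s.fwd then ε s.bond else (ε s.bond)⁻¹)) * holAt ε γ := by rw [hs]
      _ = g * ((if s.fwd then ε s.bond else (ε s.bond)⁻¹) * holAt ε γ) := by rw [mul_assoc]

/-- **Holonomy of a centrally twisted field**: `𝒰(γ)(ε·U) = 𝒰(γ)(ε) · 𝒰(γ)(U)` when all `ε(b)` are central. [folklore] -/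
theorem holAt_centralMul (ε U : GaugeField P j G) (hε : ∀ b (g : G), ε b * g = g * ε b) :
    ∀ γ : List (LStep P j), holAt (fun b => ε b * U b) γ = holAt ε γ * holAt U γ
  | [] => by rw [holAt_nil, holAt_nil, holAt_nil, one_mul]
  | s :: γ => by
    rw [holAt_cons, holAt_cons, holAt_cons, holAt_centralMul ε U hε γ]
    cases s.fwd
    · simp only [Bool.false_eq_true, if_false]
      rw [mul_inv_rev, ← central_inv (hε s.bond) (U s.bond)⁻¹]
      calc (ε s.bond)⁻¹ * (U s.bond)⁻¹ * (holAt ε γ * holAt U γ)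
          = (ε s.bond)⁻¹ * ((U s.bond)⁻¹ * holAt ε γ) * holAt U γ := by simp only [mul_assoc]
        _ = (ε s.bond)⁻¹ * (holAt ε γ * (U s.bond)⁻¹) * holAt U γ := by rw [central_holAt ε hε γ]
        _ = (ε s.bond)⁻¹ * holAt ε γ * ((U s.bond)⁻¹ * holAt U γ) := by simp only [mul_assoc]
    · simp only [if_true]
      calc ε s.bond * U s.bond * (holAt ε γ * holAt U γ)
          = ε s.bond * (U s.bond * holAt ε γ) * holAt U γ := by simp only [mul_assoc]
        _ = ε s.bond * (holAt ε γ * U s.bond) * holAt U γ := by rw [central_holAt ε hε γ]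
        _ = ε s.bond * holAt ε γ * (U s.bond * holAt U γ) := by simp only [mul_assoc]

/-- If every `ε(b) ∈ {1, z}` with `z² = 1`, every holonomy of `ε` is `1` or `z`. [folklore] -/
theorem holAt_mem_of_sign (ε : GaugeField P j G) {z : G} (hz2 : z * z = 1) (hε : ∀ b, ε b = 1 ∨ ε b = z) :
    ∀ γ : List (LStep P j), holAt ε γ = 1 ∨ holAt ε γ = z
  | [] => Or.inl (holAt_nil ε)
  | s :: γ => by
    have hzinv : z⁻¹ = z := inv_eq_of_mul_eq_one_right hz2
    have hs : (if s.fwd then ε s.bond else (ε s.bond)⁻¹) = 1 ∨ (if s.fwd then ε s.bond else (ε s.bond)⁻¹) = z := by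
      rcases hε s.bond with h | h <;> · rw [h]; split_ifs <;> simp [hzinv]
    rw [holAt_cons]
    rcases hs with h1 | h1 <;> rcases holAt_mem_of_sign ε hz2 hε γ with h2 | h2 <;> rw [h1, h2] <;> simp [hz2]

/-- Plaquette variable of a centrally twisted field. [folklore] -/
theorem plaqHol_centralMul (ε U : GaugeField P j G) (hε : ∀ b (g : G), ε b * g = g * ε b) (p : Plaq P j) :
    GaugeField.plaqHol (fun b => ε b * U b) p = GaugeField.plaqHol ε p * GaugeField.plaqHol U p := by
  -- the plaquette variable is the holonomy of the plaquette walk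
  have key : ∀ W : GaugeField P j G, GaugeField.plaqHol W p = holAt W (walk p.src (T4ReflectionCone.plaqWord p.μ p.ν)) := by
    intro W
    rw [T4ReflectionCone.walk_plaqWord]
    simp only [holAt, List.map_cons, List.map_nil, List.prod_cons, List.prod_nil, if_true, Bool.false_eq_true, if_false,
      mul_one, GaugeField.plaqHol, mul_assoc]
  rw [key, key, key, holAt_centralMul ε U hε]

/-! ## §2 The sign set `M` and the wild field -/

/-- `b ∈ M`: a `μ₀`-bond strictly inside its block in direction `μ₀` (offset in `[1, L−3]`), off the central `ν₁`-plane, with even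
`ν₁ + ν₂` offset sum. -/
def InM (μ₀ ν₁ ν₂ : Fin P.d) (b : PBond P j) : Prop :=
  b.dir = μ₀ ∧ 1 ≤ offset b.src μ₀ ∧ offset b.src μ₀ + 3 ≤ P.L ∧ offset b.src ν₁ ≠ (P.L - 1) / 2 ∧
    Even (offset b.src ν₁ + offset b.src ν₂)

instance (μ₀ ν₁ ν₂ : Fin P.d) : DecidablePred (InM (P := P) (j := j) μ₀ ν₁ ν₂) := fun b => by
  unfold InM; infer_instance

/-- The central sign field: `z` on `M`, `1` elsewhere. -/
def signField (z : G) (μ₀ ν₁ ν₂ : Fin P.d) : GaugeField P j G := fun b => if InM μ₀ ν₁ ν₂ b then z else 1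

/-- **The wild lift** `U^w = ε · faceSec V`. -/
def wild (z : G) (μ₀ ν₁ ν₂ : Fin P.d) (V : GaugeField P (j+1) G) : GaugeField P j G :=
  fun b => signField z μ₀ ν₁ ν₂ b * faceSec V b

theorem signField_mem (z : G) (μ₀ ν₁ ν₂ : Fin P.d) (b : PBond P j) :
    signField (P := P) (j := j) z μ₀ ν₁ ν₂ b = 1 ∨ signField (P := P) (j := j) z μ₀ ν₁ ν₂ b = z := by
  unfold signField; split_ifs
  · exact Or.inr rfl
  · exact Or.inl rfl

theorem signField_central {z : G} (hz : ∀ g : G, z * g = g * z) (μ₀ ν₁ ν₂ : Fin P.d) (b : PBond P j) (g : G) :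
    signField (P := P) (j := j) z μ₀ ν₁ ν₂ b * g = g * signField (P := P) (j := j) z μ₀ ν₁ ν₂ b := by
  rcases signField_mem (P := P) (j := j) z μ₀ ν₁ ν₂ b with h | h <;> rw [h]
  · rw [one_mul, mul_one]
  · exact hz g

/-! ## §3 The wild lift lies in the averaging fibre of `V` -/

/-- `emb y` is the block site with all offsets `(L−1)/2`. -/
theorem emb_eq_blockSite (y : Site P (j+1)) :
    emb y = Site.blockSite y (fun _ => ⟨(P.L - 1) / 2, half_lt P⟩) := rfl

/-- No bond of a central line belongs to `M` (`ν₁ ≠ μ₀`). -/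
theorem not_inM_line (hj : j + 1 ≤ P.m + P.K) {μ₀ ν₁ ν₂ : Fin P.d} (h01 : μ₀ ≠ ν₁) (c : PBond P (j+1)) (t : ℕ) :
    ¬ InM μ₀ ν₁ ν₂ (line c t) := by
  rintro ⟨hdir, -, -, hν₁, -⟩
  apply hν₁
  change offset (lineSite c t) ν₁ = _
  have hcd : c.dir = μ₀ := hdir
  have hne : ν₁ ≠ c.dir := by rw [hcd]; exact h01.symm
  unfold offset
  rw [show (lineSite c t) ν₁ = (emb c.src) ν₁ from Function.update_of_ne hne _ _]
  have := offset_blockSite hj c.src (fun _ => (⟨(P.L - 1) / 2, half_lt P⟩ : Fin P.L)) ν₁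
  unfold offset at this
  rw [emb_eq_blockSite]
  exact this

theorem pathProd_congr (U U' : GaugeField P j G) (c : PBond P (j+1)) (h : ∀ t, U (line c t) = U' (line c t)) :
    ∀ n, pathProd U c n = pathProd U' c n
  | 0 => rfl
  | n+1 => by
    show pathProd U c n * U (line c n) = pathProd U' c n * U' (line c n)
    rw [pathProd_congr U U' c h n, h n]

theorem axialAvg_wild (hj : j + 1 ≤ P.m + P.K) (z : G) {μ₀ ν₁ ν₂ : Fin P.d} (h01 : μ₀ ≠ ν₁) (V : GaugeField P (j+1) G) :
    axialAvg (wild z μ₀ ν₁ ν₂ V) = V := by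
  funext c
  show pathProd (wild z μ₀ ν₁ ν₂ V) c P.L = V c
  rw [pathProd_congr (wild z μ₀ ν₁ ν₂ V) (faceSec V) c (fun t => by
    show signField z μ₀ ν₁ ν₂ (line c t) * faceSec V (line c t) = faceSec V (line c t)
    rw [signField, if_neg (not_inM_line hj h01 c t), one_mul]) P.L]
  exact congrFun (axialAvg_faceSec hj V) c

/-- Every (0.4) loop variable of the wild lift is `1` or `z`. -/
theorem loopHol_wild_mem (hj : j + 1 ≤ P.m + P.K) {z : G} (hz : ∀ g : G, z * g = g * z) (hz2 : z * z = 1)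
    (μ₀ ν₁ ν₂ : Fin P.d) (V : GaugeField P (j+1) G) (c : PBond P (j+1)) (i : Idx P) :
    loopHol (wild z μ₀ ν₁ ν₂ V) c i = 1 ∨ loopHol (wild z μ₀ ν₁ ν₂ V) c i = z := by
  have h1 : loopHol (wild z μ₀ ν₁ ν₂ V) c i = loopHol (signField z μ₀ ν₁ ν₂) c i * loopHol (faceSec V) c i :=
    holAt_centralMul _ _ (signField_central hz μ₀ ν₁ ν₂) _
  rw [h1, loopHol_faceSec hj V c i, mul_one]
  exact holAt_mem_of_sign _ hz2 (signField_mem z μ₀ ν₁ ν₂) _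

/-- The correction factor of the wild lift is `1` (either branch of the small-field guard). -/
theorem corr_wild (hj : j + 1 ≤ P.m + P.K) (ℰ : LoopAverage G) (hE : ∀ n : ℕ, ℰ.E (fun _ : Fin (n + 1) => (1 : G)) = 1)
    {z : G} (hz : ∀ g : G, z * g = g * z) (hz2 : z * z = 1) (hzδ : ℰ.δ ≤ dist1 z)
    (μ₀ ν₁ ν₂ : Fin P.d) (V : GaugeField P (j+1) G) (c : PBond P (j+1)) :
    corr ℰ (wild z μ₀ ν₁ ν₂ V) c = 1 := by
  unfold corr
  split_ifs with hS
  · have hl : loopHol (wild z μ₀ ν₁ ν₂ V) c = fun _ => 1 := funext fun i =>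
      (loopHol_wild_mem hj hz hz2 μ₀ ν₁ ν₂ V c i).resolve_right fun h => by
        have := hS i; rw [h] at this; exact absurd hzδ (not_le.mpr this)
    rw [hl]
    exact hE _
  · rfl

/-- **The wild lift is in the fibre: `avgFun ℰ U^w = V`.** -/
theorem avgFun_wild (hj : j + 1 ≤ P.m + P.K) (ℰ : LoopAverage G) (hE : ∀ n : ℕ, ℰ.E (fun _ : Fin (n + 1) => (1 : G)) = 1)
    {z : G} (hz : ∀ g : G, z * g = g * z) (hz2 : z * z = 1) (hzδ : ℰ.δ ≤ dist1 z)
    {μ₀ ν₁ ν₂ : Fin P.d} (h01 : μ₀ ≠ ν₁) (V : GaugeField P (j+1) G) :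
    avgFun ℰ (wild z μ₀ ν₁ ν₂ V) = V := by
  funext c
  show corr ℰ (wild z μ₀ ν₁ ν₂ V) c * axialAvg (wild z μ₀ ν₁ ν₂ V) c = V c
  rw [corr_wild hj ℰ hE hz hz2 hzδ, one_mul, axialAvg_wild hj z h01]

/-! ## §4 The action of the wild lift: a fixed fraction of the plaquettes carry `z` -/

/-- Offsets of the counted plaquettes: `(a+1, b', c, 0, …)` with `b'` skipping the centre `(L−1)/2`. -/
def rOf {μ₀ ν₁ ν₂ : Fin P.d} (a : Fin (P.L - 3)) (b : Fin (P.L - 1)) (c : Fin (P.L - 1)) : Fin P.d → Fin P.L := fun ν =>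
  if ν = μ₀ then ⟨a + 1, by omega⟩
  else if ν = ν₁ then ⟨if (b : ℕ) < (P.L - 1) / 2 then b else b + 1, by split_ifs <;> omega⟩
  else if ν = ν₂ then ⟨c, by omega⟩ else ⟨0, P.L_pos⟩

/-- The counted plaquettes. -/
def plaqOf {μ₀ ν₁ ν₂ : Fin P.d} (h02 : μ₀ < ν₂) (d : Site P (j+1) × Fin (P.L - 3) × Fin (P.L - 1) × Fin (P.L - 1)) : Plaq P j :=
  ⟨Site.blockSite d.1 (rOf (μ₀ := μ₀) (ν₁ := ν₁) (ν₂ := ν₂) d.2.1 d.2.2.1 d.2.2.2), μ₀, ν₂, h02⟩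

theorem rOf_μ₀ {μ₀ ν₁ ν₂ : Fin P.d} (a : Fin (P.L - 3)) (b c : Fin (P.L - 1)) :
    ((rOf (μ₀ := μ₀) (ν₁ := ν₁) (ν₂ := ν₂) a b c μ₀ : Fin P.L) : ℕ) = a + 1 := by
  simp [rOf]

theorem rOf_ν₁ {μ₀ ν₁ ν₂ : Fin P.d} (h01 : μ₀ ≠ ν₁) (a : Fin (P.L - 3)) (b c : Fin (P.L - 1)) :
    ((rOf (μ₀ := μ₀) (ν₁ := ν₁) (ν₂ := ν₂) a b c ν₁ : Fin P.L) : ℕ) =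
      if (b : ℕ) < (P.L - 1) / 2 then (b : ℕ) else b + 1 := by
  simp [rOf, h01.symm]

theorem rOf_ν₂ {μ₀ ν₁ ν₂ : Fin P.d} (h02 : μ₀ ≠ ν₂) (h12 : ν₁ ≠ ν₂) (a : Fin (P.L - 3)) (b c : Fin (P.L - 1)) :
    ((rOf (μ₀ := μ₀) (ν₁ := ν₁) (ν₂ := ν₂) a b c ν₂ : Fin P.L) : ℕ) = c := by
  simp [rOf, h02.symm, h12.symm]

theorem plaqOf_injective (hj : j + 1 ≤ P.m + P.K) {μ₀ ν₁ ν₂ : Fin P.d} (h01 : μ₀ ≠ ν₁) (h02 : μ₀ < ν₂) (h12 : ν₁ ≠ ν₂) :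
    Function.Injective (plaqOf (P := P) (j := j) (ν₁ := ν₁) h02) := by
  rintro ⟨y, a, b, c⟩ ⟨y', a', b', c'⟩ h
  have hsrc : Site.blockSite y (rOf (μ₀ := μ₀) (ν₁ := ν₁) (ν₂ := ν₂) a b c) =
      Site.blockSite y' (rOf (μ₀ := μ₀) (ν₁ := ν₁) (ν₂ := ν₂) a' b' c') := congrArg Plaq.src h
  have hy : y = y' := by
    have := congrArg blockOf hsrc
    rwa [Site.blockOf_blockSite hj, Site.blockOf_blockSite hj] at this
  subst hy
  have hoff : ∀ ν, ((rOf (μ₀ := μ₀) (ν₁ := ν₁) (ν₂ := ν₂) a b c ν : Fin P.L) : ℕ) =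
      ((rOf (μ₀ := μ₀) (ν₁ := ν₁) (ν₂ := ν₂) a' b' c' ν : Fin P.L) : ℕ) := fun ν => by
    have h1 := offset_blockSite hj y (rOf (μ₀ := μ₀) (ν₁ := ν₁) (ν₂ := ν₂) a b c) ν
    have h2 := offset_blockSite hj y (rOf (μ₀ := μ₀) (ν₁ := ν₁) (ν₂ := ν₂) a' b' c') ν
    rw [hsrc] at h1
    exact h1.symm.trans h2
  have ha := hoff μ₀; rw [rOf_μ₀, rOf_μ₀] at ha
  have hb := hoff ν₁; rw [rOf_ν₁ h01, rOf_ν₁ h01] at hb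
  have hc := hoff ν₂; rw [rOf_ν₂ (ne_of_lt h02) h12, rOf_ν₂ (ne_of_lt h02) h12] at hc
  have ha' : a = a' := Fin.ext (by omega)
  have hb' : b = b' := Fin.ext (by split_ifs at hb <;> omega)
  have hc' : c = c' := Fin.ext hc
  subst ha' hb' hc'
  rfl

/-- **The plaquette variable of the wild lift at a counted plaquette is `z`.** -/
theorem plaqHol_wild_plaqOf (hj : j + 1 ≤ P.m + P.K) {z : G} (hz : ∀ g : G, z * g = g * z) (hz2 : z * z = 1)
    {μ₀ ν₁ ν₂ : Fin P.d} (h01 : μ₀ ≠ ν₁) (h02 : μ₀ < ν₂) (h12 : ν₁ ≠ ν₂) (V : GaugeField P (j+1) G)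
    (d : Site P (j+1) × Fin (P.L - 3) × Fin (P.L - 1) × Fin (P.L - 1)) :
    GaugeField.plaqHol (wild z μ₀ ν₁ ν₂ V) (plaqOf (ν₁ := ν₁) h02 d) = z := by
  obtain ⟨y, a, b, c⟩ := d
  have hL := P.hL.2
  have hzinv : z⁻¹ = z := inv_eq_of_mul_eq_one_right hz2
  set x : Site P j := Site.blockSite y (rOf (μ₀ := μ₀) (ν₁ := ν₁) (ν₂ := ν₂) a b c) with hx
  -- offsets of `x` and `x + e_{ν₂}`
  have oμ : offset x μ₀ = a + 1 := by rw [hx, offset_blockSite hj, rOf_μ₀]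
  have oν₁ : offset x ν₁ = if (b : ℕ) < (P.L - 1) / 2 then (b : ℕ) else b + 1 := by rw [hx, offset_blockSite hj, rOf_ν₁ h01]
  have oν₂ : offset x ν₂ = c := by rw [hx, offset_blockSite hj, rOf_ν₂ (ne_of_lt h02) h12]
  have sμ : offset (x.shift ν₂) μ₀ = a + 1 := by rw [offset_shift_ne x (ne_of_lt h02), oμ]
  have sν₁ : offset (x.shift ν₂) ν₁ = if (b : ℕ) < (P.L - 1) / 2 then (b : ℕ) else b + 1 := by
    rw [offset_shift_ne x h12, oν₁]
  have sν₂ : offset (x.shift ν₂) ν₂ = c + 1 := by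
    rw [offset_shift_self hj, oν₂, Nat.mod_eq_of_lt (by omega)]
  -- the section's plaquette variable is `1` (not an edge plaquette: μ₀-offset `a+1 ≤ L−3 < L−1`)
  have hsec : GaugeField.plaqHol (faceSec V) (plaqOf (ν₁ := ν₁) h02 (y, a, b, c)) = 1 := by
    rw [plaqHol_faceSec hj, if_neg]
    rintro ⟨h1, -⟩
    change offset x μ₀ = P.L - 1 at h1
    omega
  -- the sign plaquette variable is `z`
  have hν₂bond : ∀ s : Site P j, signField (P := P) (j := j) z μ₀ ν₁ ν₂ ⟨s, ν₂⟩ = 1 := fun s => by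
    rw [signField, if_neg]; rintro ⟨h, -⟩; exact absurd h (ne_of_lt h02).symm
  have hb' : (if (b : ℕ) < (P.L - 1) / 2 then (b : ℕ) else b + 1) ≠ (P.L - 1) / 2 := by split_ifs <;> omega
  have hsign : GaugeField.plaqHol (signField z μ₀ ν₁ ν₂) (plaqOf (ν₁ := ν₁) h02 (y, a, b, c)) = z := by
    show signField z μ₀ ν₁ ν₂ ⟨x, μ₀⟩ * signField z μ₀ ν₁ ν₂ ⟨x.shift μ₀, ν₂⟩ *
        (signField z μ₀ ν₁ ν₂ ⟨x.shift ν₂, μ₀⟩)⁻¹ * (signField z μ₀ ν₁ ν₂ ⟨x, ν₂⟩)⁻¹ = z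
    rw [hν₂bond, hν₂bond, inv_one, mul_one, mul_one]
    by_cases hpar : Even ((if (b : ℕ) < (P.L - 1) / 2 then (b : ℕ) else b + 1) + c)
    · have h1 : signField (P := P) (j := j) z μ₀ ν₁ ν₂ ⟨x, μ₀⟩ = z := by
        rw [signField, if_pos]
        refine ⟨rfl, ?_, ?_, ?_, ?_⟩ <;> simp only [] <;> (try rw [oμ]) <;> (try rw [oν₁]) <;> (try rw [oν₂])
        · omega
        · have := a.isLt; omega
        · exact hb'
        · exact hpar
      have h3 : signField (P := P) (j := j) z μ₀ ν₁ ν₂ ⟨x.shift ν₂, μ₀⟩ = 1 := by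
        rw [signField, if_neg]
        rintro ⟨-, -, -, -, h⟩
        change Even (offset (x.shift ν₂) ν₁ + offset (x.shift ν₂) ν₂) at h
        rw [sν₁, sν₂, ← add_assoc] at h
        exact Nat.even_add_one.mp h hpar
      rw [h1, h3, inv_one, mul_one]
    · have h1 : signField (P := P) (j := j) z μ₀ ν₁ ν₂ ⟨x, μ₀⟩ = 1 := by
        rw [signField, if_neg]
        rintro ⟨-, -, -, -, h⟩
        change Even (offset x ν₁ + offset x ν₂) at h
        rw [oν₁, oν₂] at h
        exact hpar h
      have h3 : signField (P := P) (j := j) z μ₀ ν₁ ν₂ ⟨x.shift ν₂, μ₀⟩ = z := by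
        rw [signField, if_pos]
        refine ⟨rfl, ?_, ?_, ?_, ?_⟩
        · change 1 ≤ offset (x.shift ν₂) μ₀; rw [sμ]; omega
        · change offset (x.shift ν₂) μ₀ + 3 ≤ P.L; rw [sμ]; have := a.isLt; omega
        · change offset (x.shift ν₂) ν₁ ≠ _; rw [sν₁]; exact hb'
        · change Even (offset (x.shift ν₂) ν₁ + offset (x.shift ν₂) ν₂); rw [sν₁, sν₂, ← add_assoc]
          exact Nat.even_add_one.mpr hpar
      rw [h1, h3, one_mul, hzinv]
  have hw : wild z μ₀ ν₁ ν₂ V = fun b => signField z μ₀ ν₁ ν₂ b * faceSec V b := rfl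
  rw [hw, plaqHol_centralMul _ _ (signField_central hz μ₀ ν₁ ν₂), hsign, hsec, mul_one]

/-- **THE ACTION OF THE WILD LIFT**: `(1 − reTr z) · #Site_{j+1} · (L−3)(L−1)² ≤ Σ_p (1 − reTr U^w(∂p))`. -/
theorem action_wild (hj : j + 1 ≤ P.m + P.K) {z : G} (hz : ∀ g : G, z * g = g * z) (hz2 : z * z = 1)
    {μ₀ ν₁ ν₂ : Fin P.d} (h01 : μ₀ ≠ ν₁) (h02 : μ₀ < ν₂) (h12 : ν₁ ≠ ν₂) (V : GaugeField P (j+1) G) :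
    (1 - reTr z) * ((Fintype.card (Site P (j+1)) * ((P.L - 3) * ((P.L - 1) * (P.L - 1))) : ℕ) : ℝ) ≤
      ∑ p : Plaq P j, (1 - reTr (GaugeField.plaqHol (wild z μ₀ ν₁ ν₂ V) p)) := by
  classical
  set D := Site P (j+1) × Fin (P.L - 3) × Fin (P.L - 1) × Fin (P.L - 1)
  have hcard : Fintype.card D = Fintype.card (Site P (j+1)) * ((P.L - 3) * ((P.L - 1) * (P.L - 1))) := by
    simp only [D, Fintype.card_prod, Fintype.card_fin]
  have hnonneg : ∀ p : Plaq P j, 0 ≤ 1 - reTr (GaugeField.plaqHol (wild z μ₀ ν₁ ν₂ V) p) := fun p =>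
    sub_nonneg.mpr (GaugeGroup.reTr_le_one _)
  calc (1 - reTr z) * ((Fintype.card (Site P (j+1)) * ((P.L - 3) * ((P.L - 1) * (P.L - 1))) : ℕ) : ℝ)
      = ∑ _d : D, (1 - reTr z) := by
        rw [Finset.sum_const, Finset.card_univ, hcard, nsmul_eq_mul, mul_comm]
    _ = ∑ d : D, (1 - reTr (GaugeField.plaqHol (wild z μ₀ ν₁ ν₂ V) (plaqOf (ν₁ := ν₁) h02 d))) := by
        refine Finset.sum_congr rfl fun d _ => ?_
        rw [plaqHol_wild_plaqOf hj hz hz2 h01 h02 h12 V d]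
    _ = ∑ p ∈ Finset.univ.image (plaqOf (ν₁ := ν₁) h02), (1 - reTr (GaugeField.plaqHol (wild z μ₀ ν₁ ν₂ V) p)) := by
        rw [Finset.sum_image (fun d _ d' _ h => plaqOf_injective hj h01 h02 h12 h)]
    _ ≤ ∑ p : Plaq P j, (1 - reTr (GaugeField.plaqHol (wild z μ₀ ν₁ ν₂ V) p)) :=
        Finset.sum_le_sum_of_subset_of_nonneg (Finset.subset_univ _) fun p _ _ => hnonneg p

end Generic

/-! ## §5 `G = SU(2)`, `z = −1`, and the T3 tower: `descend (wildLift V) = V`, action `≥ 2·#Site·(L−3)(L−1)²` -/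

section SU2

open T3ContinuumYM3Torus T3NestedUnitLaws T3UnitLawDensityEML T3LevelShift
open T3DescentFibreTower (expMeanLogSU_E_one)

/-- `−1 ∈ SU(2)` (the non-trivial central element). -/
def negOne : Matrix.specialUnitaryGroup (Fin 2) ℂ :=
  ⟨-1, by
    rw [Matrix.mem_specialUnitaryGroup_iff, Matrix.mem_unitaryGroup_iff]
    refine ⟨by simp, ?_⟩
    rw [Matrix.det_neg, Matrix.det_one, Fintype.card_fin]; norm_num⟩

@[simp] theorem coe_negOne : ((negOne : Matrix.specialUnitaryGroup (Fin 2) ℂ) : Matrix (Fin 2) (Fin 2) ℂ) = -1 := rfl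

theorem negOne_central (g : Matrix.specialUnitaryGroup (Fin 2) ℂ) : negOne * g = g * negOne :=
  Subtype.ext (by simp)

theorem negOne_mul_negOne : negOne * negOne = 1 := Subtype.ext (by simp)

/-- `reTr(−1) = −1` (normalised trace). -/
theorem reTr_negOne : reTr negOne = -1 := by
  show UnitaryModel.nReTr (Literature.MathematicalPhysics.QuantumLattice.fundamentalRep (Fin 2) negOne) = -1
  rw [Literature.MathematicalPhysics.QuantumLattice.fundamentalRep_apply, coe_negOne, UnitaryModel.nReTr, Matrix.trace_neg, Matrix.trace_one, Fintype.card_fin]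
  norm_num

/-- `dist1(−1) ≥ 2`, from `1 − reTr u ≤ ½ dist1 u²` (B10 (11)). -/
theorem two_le_dist1_negOne : 2 ≤ dist1 negOne := by
  have h := B10Eq5RegularAction.one_sub_reTr_le_specialUnitaryGroup negOne
  rw [reTr_negOne] at h
  have h0 : 0 ≤ dist1 negOne := GaugeGroup.dist1_nonneg _
  nlinarith

/-- The printed small-loop average's threshold is below `dist1(−1)`: `ℰp.δ = min(1/3, π/2) ≤ 2`. -/
theorem ℰp_δ_le_dist1_negOne : ℰp.δ ≤ dist1 negOne := by
  have h1 : ℰp.δ ≤ 1 / 3 := by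
    show ExpMeanLog.deltaSU (Fin 2) ≤ 1 / 3
    unfold ExpMeanLog.deltaSU; exact min_le_left _ _
  linarith [two_le_dist1_negOne]

variable (F : T3Family)

/-- **The wild lift in the tower**: the central-sign twist of the face section, read at level `0` of the `(j+1)`-th lattice
(`μ₀ = 0`, `ν₁ = 1`, `ν₂ = 2`). -/
def wildLift (j : ℕ) (V : GaugeField (F.P j) 0 (Matrix.specialUnitaryGroup (Fin 2) ℂ)) :
    GaugeField (F.P (j+1)) 0 (Matrix.specialUnitaryGroup (Fin 2) ℂ) :=
  wild negOne (⟨0, by show 0 < 3; omega⟩ : Fin (F.P (j+1)).d) ⟨1, by show 1 < 3; omega⟩ ⟨2, by show 2 < 3; omega⟩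
    (fieldShift (sitesPerDir_descend F j 0).symm V)

/-- **`descend (wildLift V) = V`**: the wild lift lies in the one-step averaging fibre of `V` for the tree's concrete `ℰp`. -/
theorem descend_wildLift (j : ℕ) (V : GaugeField (F.P j) 0 (Matrix.specialUnitaryGroup (Fin 2) ℂ)) :
    descend F ℰp j (wildLift F j V) = V := by
  have hj : 0 + 1 ≤ (F.P (j+1)).m + (F.P (j+1)).K := by show 0 + 1 ≤ F.m + (j + 1); omega
  have h01 : (⟨0, by show 0 < 3; omega⟩ : Fin (F.P (j+1)).d) ≠ ⟨1, by show 1 < 3; omega⟩ := by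
    intro h; have := congrArg Fin.val h; simp at this
  have hav : (BlockAveraging.blockAvg (P := F.P (j + 1)) (j := 0) ℰp).avg (wildLift F j V) =
      fieldShift (sitesPerDir_descend F j 0).symm V := by
    rw [BlockAveraging.blockAvg_avg]
    exact avgFun_wild hj ℰp expMeanLogSU_E_one negOne_central negOne_mul_negOne ℰp_δ_le_dist1_negOne h01 _
  exact (congrArg (fieldShift (sitesPerDir_descend F j 0)) hav).trans (fieldShift_symm_fieldShift _ V)

/-- **The action of the wild lift**: `2 · #Site((F.P (j+1)), level 1) · (L−3)(L−1)² ≤ Σ_p (1 − reTr (wildLift V)(∂p))`,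
uniformly in `V`. -/
theorem action_wildLift (j : ℕ) (V : GaugeField (F.P j) 0 (Matrix.specialUnitaryGroup (Fin 2) ℂ)) :
    2 * ((Fintype.card (Site (F.P (j+1)) 1) * ((F.L - 3) * ((F.L - 1) * (F.L - 1))) : ℕ) : ℝ) ≤
      ∑ p : Plaq (F.P (j+1)) 0, (1 - reTr (GaugeField.plaqHol (wildLift F j V) p)) := by
  have hj : 0 + 1 ≤ (F.P (j+1)).m + (F.P (j+1)).K := by show 0 + 1 ≤ F.m + (j + 1); omega
  have h01 : (⟨0, by show 0 < 3; omega⟩ : Fin (F.P (j+1)).d) ≠ ⟨1, by show 1 < 3; omega⟩ := by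
    intro h; have := congrArg Fin.val h; simp at this
  have h02 : (⟨0, by show 0 < 3; omega⟩ : Fin (F.P (j+1)).d) < ⟨2, by show 2 < 3; omega⟩ := by
    show (0 : ℕ) < 2; omega
  have h12 : (⟨1, by show 1 < 3; omega⟩ : Fin (F.P (j+1)).d) ≠ ⟨2, by show 2 < 3; omega⟩ := by
    intro h; have := congrArg Fin.val h; simp at this
  have h := action_wild hj negOne_central negOne_mul_negOne h01 h02 h12 (fieldShift (sitesPerDir_descend F j 0).symm V)
  rw [reTr_negOne] at h
  have hL : (F.P (j+1)).L = F.L := rfl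
  rw [hL] at h
  have h2 : (1 - (-1 : ℝ)) = 2 := by norm_num
  rw [h2] at h
  exact h

end SU2

end

end Summit.QuantumFields.YangMills.Cruxes.OneStepBackwardContraction.TwistedFibre.WildLift
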